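import Summits.CriticalPhenomena.PercolationContinuityZ3.Theorems.Transplant.SkelFrmQuasiBChoiceAtQ3V
import Summits.CriticalPhenomena.PercolationContinuityZ3.Theorems.Transplant.SkelFrmQuasi1ChoiceLTKPx
import Summits.CriticalPhenomena.PercolationContinuityZ3.Theorems.Transplant.SkelFrmQuasiBParamsKitS
import Summits.CriticalPhenomena.PercolationContinuityZ3.Theorems.Transplant.SkelFrmQuasi1ParamsLBL
import Summits.CriticalPhenomena.PercolationContinuityZ3.Theorems.Transplant.SkelFrmQuasiBParamsBridge0
import Summits.CriticalPhenomena.PercolationContinuityZ3.Theorems.Transplant.PlanarSkeletonFrmQuasiDefs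
import Summits.CriticalPhenomena.PercolationContinuityZ3.Theorems.Transplant.PlanarSkeletonFrmQuasiProxies
import Summits.CriticalPhenomena.PercolationContinuityZ3.Theorems.Transplant.SkelFrmQuasi1ChoiceDefs
import Summits.CriticalPhenomena.PercolationContinuityZ3.Theorems.Transplant.SkelFrmQuasi1ChoiceDefsPx
import Summits.CriticalPhenomena.PercolationContinuityZ3.Theorems.Transplant.SkelFrmQuasi1ParamsLF
import Summits.CriticalPhenomena.PercolationContinuityZ3.Theorems.Transplant.SkelFrmQuasi1ParamsPO
import Summits.CriticalPhenomena.PercolationContinuityZ3.Theorems.Transplant.SkelFrmQuasi1SlotTypes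
import Summits.CriticalPhenomena.PercolationContinuityZ3.Theorems.Transplant.SkelFrmQuasiBChoiceDefs
import Summits.CriticalPhenomena.PercolationContinuityZ3.Theorems.Transplant.SkelFrmQuasiBChoiceDefs3
import Summits.CriticalPhenomena.PercolationContinuityZ3.Theorems.Transplant.SkelFrmQuasiBChoiceDefsV
import Summits.CriticalPhenomena.PercolationContinuityZ3.Theorems.Transplant.SkelFrmQuasiBParamsBridgeF
import Summits.CriticalPhenomena.PercolationContinuityZ3.Theorems.Transplant.SkelFrmQuasiBParamsLF
import Summits.CriticalPhenomena.PercolationContinuityZ3.Theorems.Transplant.SkelFrmQuasi1SlotTypes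
import HarnessLib

/-!
# GEN-Q PORT (WAVE-Q table v0.8 section 2, row G265, U-level L?; captain R-6/R-7 2026-08-27: carrier token swap `PlanarSkeletonFrmFrom ↦ PlanarSkeletonFrmQuasi`)
# of the tree module «Transplant/SkelFrmFromBChoiceDefsVPx» (sha256 bc6c143b1a5d382a…) onto the quasi-step carrier `PlanarSkeletonFrmQuasi` (p507026): «SkelFrmQuasiBChoiceDefsVPx»

ORIGINAL TITLE: 

builds on p205010 (kernel theorem, internal audit signed; external expert review pending) — nothing in this file uses p205010; NOTHING is claimed about any open node
((N3-b), the end state).  Lane `prim-bschramm`, seat `prim-bschramm-p3` (gen 30; design owner; tool = captain gen-1 g4's port_genq.py R-14 --cone + p3-g30 slot-value patch T1).  Helper file (`--supports stmt-CriticalPhenomena-4575 --as helper`).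
PORT RULES (U-wave r1–r4 re-used, GEN-Q hunk classes of p3-g29 #6136): declaration order, names and proof texts are those of «SkelFrmFromBChoiceDefsVPx», byte-identical except
(i) the carrier token `PlanarSkeletonFrmFrom ↦ PlanarSkeletonFrmQuasi` in binders, `namespace`/`end` lines and qualified names (module names `SkelFrmFrom… ↦ SkelFrmQuasi…`
in imports of already-ported rows); (ii) `Φ.step ↦ Φ.qstep` with the called Steps lemma replaced by its `…Q`/`_q` twin and the cost `Φ.M` threaded (none in this file unless
listed below); (iii) `Φ.cyl_connected ↦ Φ.cyl_reach` readers (none unless listed); (iv) graph-ball radii / window floors ×`Φ.M` (none unless listed).  Carrier-free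
residents stay imported/exported from the original «SkelFrmBChoiceDefsVPx» exactly as in the FrmFrom port.  Docstrings and citations are the original's.

-/

noncomputable section

open scoped Classical

namespace Summit.CriticalPhenomena.PercolationContinuityZ3.Theorems.Transplant

open MeasureTheory Literature.Probability.Percolation Literature.Probability.LatticeModels SimpleGraph KNCells
open Literature.Barriers.CriticalPhenomena (HasExponentialGrowth)

namespace PlanarSkeletonFrmQuasi

open SkelConc (Consts)
open Skelφ (oriφ trφ)
open Skelφ.StepI (DataN DataNS OutNS)

namespace NegB

open Neg


-- GEN-Q T3 (p3-g30): residents/aliases of the row-less module(s) «SkelFrmFromBParamsKitA» used below, re-exported here.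
export PlanarSkeletonFrmFrom.NegB (nKit nKit_facts)

/-! ## §1 The choice data of record under proxies: `choiceAtQ3VPx` (seed floor `max m₀ D`) -/

section Values

variable (κ : Consts) {V : Type} [DecidableEq V] [Countable V] {G : SimpleGraph V} [G.LocallyFinite] (Φ : PlanarSkeletonFrmQuasi G) (t : V)
  (p : unitInterval) (D : ℕ)

variable (Pv : PSlot) (gv fv : Neg.FSlot) (Sv : SSlot) (cv hv : CSlot) (bv : BSlot)

/-- **THE N2/U CHOICES OF RECORD UNDER PROXIES AT RADIUS `D`** at `(κ, Φ, t, p)`: `choiceAtQ3V` with the least seed level raised to `max Neg.m₀ D` (WAVE-Us-MANIFEST §6 (a):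
the seed `Λ (prox c) k` must contain the centre `c`, which needs `k ≥ D` — `HasProxies.mem_fatSeq_prox`); every other field is `choiceAtQ3V`'s (`δI := δI3`, `Sz`, `SMn := SMnP`,
`Γ := ΓQV`, `FD := FDQV`, `LD := LDQV`). [cite: KozmaNitzan2024, §4 Theorem 6 (pp. 25–31)] -/
def choiceAtQ3VPx (κ : Consts) {V : Type} [DecidableEq V] [Countable V] {G : SimpleGraph V} [G.LocallyFinite] (Φ : PlanarSkeletonFrmQuasi G) (t : V) (p : unitInterval) (D : ℕ) (Pv : PSlot) (gv : Neg.FSlot) (fv : Neg.FSlot) (Sv : SSlot) (cv : CSlot) (hv : CSlot) (bv : BSlot) (hC : Φ.CylSubcritical p) : ChoiceNQ κ Φ t p hC where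
  δI := δI3 κ Φ
  m₀ := max Neg.m₀ D
  Sz := fun O => Neg.Sz O.merged
  SMn := fun O => SMnP κ Φ t p O.merged (gOf κ Φ t p O gv) (fOf κ Φ t p O fv) Pv
  Γ := fun O q => ΓQV κ Φ t p O gv fv Sv cv hv bv q
  FD := fun O q => FDQV κ Φ t p O gv fv Sv cv hv q
  LD := fun O _ => LDQV κ Φ t p O gv fv cv hv
  δI_pos := δI3_pos κ Φ
  δI_lt_one := δI3_lt_one κ Φ
  S_adm := fun O _ => ⟨Neg.Sz_adm O.merged, SMnP_adm_at κ Φ t p O.merged _ _ Pv⟩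

variable (hC : Φ.CylSubcritical p)

-- GEN-Q (R-2, captain 2026-08-27): `PlanarSkeletonFrmFrom.NegB.choiceAtQ3VPx_δI` is not in the used cone of the node top — not ported.

-- GEN-Q (R-2, captain 2026-08-27): `PlanarSkeletonFrmFrom.NegB.choiceAtQ3VPx_m₀` is not in the used cone of the node top — not ported.

-- GEN-Q (R-2, captain 2026-08-27): `PlanarSkeletonFrmFrom.NegB.choiceAtQ3VPx_Sz` is not in the used cone of the node top — not ported.

-- GEN-Q (R-2, captain 2026-08-27): `PlanarSkeletonFrmFrom.NegB.choiceAtQ3VPx_SMn` is not in the used cone of the node top — not ported.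

-- GEN-Q (R-2, captain 2026-08-27): `PlanarSkeletonFrmFrom.NegB.choiceAtQ3VPx_Γ` is not in the used cone of the node top — not ported.

-- GEN-Q (R-2, captain 2026-08-27): `PlanarSkeletonFrmFrom.NegB.choiceAtQ3VPx_FD` is not in the used cone of the node top — not ported.

-- GEN-Q (R-2, captain 2026-08-27): `PlanarSkeletonFrmFrom.NegB.choiceAtQ3VPx_LD` is not in the used cone of the node top — not ported.

-- GEN-Q (R-2, captain 2026-08-27): `PlanarSkeletonFrmFrom.NegB.choiceAtQ3VPx_scheme` is not in the used cone of the node top — not ported.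

-- GEN-Q (R-2, captain 2026-08-27): `PlanarSkeletonFrmFrom.NegB.choiceAtQ3VPx_zero` is not in the used cone of the node top — not ported.

end Values

/-! ## §2 `AtQNQ` of the Px data = `AtQNQ` of `choiceAtQ3V` and `D ≤ k`; the width floors of the GEN input layer -/

section AtQ

variable {κ : Consts} {V : Type} [DecidableEq V] [Countable V] {G : SimpleGraph V} [G.LocallyFinite] {Φ : PlanarSkeletonFrmQuasi G} {t : V} {p : unitInterval}
  {hC : Φ.CylSubcritical p} {D : ℕ} {gv fv : Neg.FSlot} {Pv : PSlot} {Sv : SSlot} {cv hv : CSlot} {bv : BSlot} {O : OutNS V} {q : unitInterval}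

/-- **`AtQNQ` of the Px data gives `AtQNQ` of `choiceAtQ3V`** (the facts are antitone in the least seed level, `Neg.m₀ ≤ max Neg.m₀ D`; the other three fields it reads agree
by `rfl`) — so every `…_of_atQV` / `…_of_atQ3` lemma of the U wave and every landed GEN input lemma serves the Px function. [folklore] -/
theorem atQ3V_of_atQ3VPx {κ : Consts} {V : Type} [DecidableEq V] [Countable V] {G : SimpleGraph V} [G.LocallyFinite] {Φ : PlanarSkeletonFrmQuasi G} {t : V} {p : unitInterval} {hC : Φ.CylSubcritical p} {D : ℕ} {gv : Neg.FSlot} {fv : Neg.FSlot} {Pv : PSlot} {Sv : SSlot} {cv : CSlot} {hv : CSlot} {bv : BSlot} {O : OutNS V} {q : unitInterval} (hAt : (choiceAtQ3VPx κ Φ t p D Pv gv fv Sv cv hv bv hC).AtQNQ O q) : (choiceAtQ3V κ Φ t p Pv gv fv Sv cv hv bv hC).AtQNQ O q :=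
  ⟨hAt.1.of_le (le_max_left _ _), hAt.2.1, hAt.2.2.1, hAt.2.2.2.1, hAt.2.2.2.2⟩

/-- … and of the landed S choices `choiceAtQ3` (through `atQ3_of_atQ3V`). [folklore] -/
theorem atQ3_of_atQ3VPx {κ : Consts} {V : Type} [DecidableEq V] [Countable V] {G : SimpleGraph V} [G.LocallyFinite] {Φ : PlanarSkeletonFrmQuasi G} {t : V} {p : unitInterval} {hC : Φ.CylSubcritical p} {D : ℕ} {gv : Neg.FSlot} {fv : Neg.FSlot} {Pv : PSlot} {Sv : SSlot} {cv : CSlot} {hv : CSlot} {bv : BSlot} {O : OutNS V} {q : unitInterval} (hAt : (choiceAtQ3VPx κ Φ t p D Pv gv fv Sv cv hv bv hC).AtQNQ O q) : (choiceAtQ3 κ Φ t p Pv gv fv Sv cv bv hC).AtQNQ O q :=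
  atQ3_of_atQ3V (atQ3V_of_atQ3VPx hAt)

-- GEN-Q (R-2, captain 2026-08-27): `PlanarSkeletonFrmFrom.NegB.atQ3VPx_of_atQ3V` is not in the used cone of the node top — not ported.

/-- **THE SEED FLOOR: `D ≤ k`** out of `AtQNQ` of the Px data (`max Neg.m₀ D ≤ k` is the first of the facts). [this work] -/
theorem D_le_k_of_atQ3VPx {κ : Consts} {V : Type} [DecidableEq V] [Countable V] {G : SimpleGraph V} [G.LocallyFinite] {Φ : PlanarSkeletonFrmQuasi G} {t : V} {p : unitInterval} {hC : Φ.CylSubcritical p} {D : ℕ} {gv : Neg.FSlot} {fv : Neg.FSlot} {Pv : PSlot} {Sv : SSlot} {cv : CSlot} {hv : CSlot} {bv : BSlot} {O : OutNS V} {q : unitInterval} (hAt : (choiceAtQ3VPx κ Φ t p D Pv gv fv Sv cv hv bv hC).AtQNQ O q) : D ≤ O.merged.k :=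
  (le_max_right _ _).trans (Skelφ.StepI.OutO.FactsO.seed hAt.1.factsO).1

/-- `D ≤ M_u` (`k ≤ M₀ ≤ M_u`) — the floor of «SkelFrmFromBChoiceZonePx»'s `hcz_of_atQPx` / `hzconn_of_atQPx`. [folklore] -/
theorem D_le_Mu_of_atQ3VPx {κ : Consts} {V : Type} [DecidableEq V] [Countable V] {G : SimpleGraph V} [G.LocallyFinite] {Φ : PlanarSkeletonFrmQuasi G} {t : V} {p : unitInterval} {hC : Φ.CylSubcritical p} {D : ℕ} {gv : Neg.FSlot} {fv : Neg.FSlot} {Pv : PSlot} {Sv : SSlot} {cv : CSlot} {hv : CSlot} {bv : BSlot} {O : OutNS V} {q : unitInterval} (hAt : (choiceAtQ3VPx κ Φ t p D Pv gv fv Sv cv hv bv hC).AtQNQ O q) : D ≤ Mu O.merged :=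
  (D_le_k_of_atQ3VPx hAt).trans (k_le_Mu O.merged (Skelφ.StepI.OutO.FactsO.seed hAt.1.factsO).2.2.1)

-- GEN-Q (R-2, captain 2026-08-27): `PlanarSkeletonFrmFrom.NegB.D_le_nS_of_atQ3VPx` is not in the used cone of the node top — not ported.

/-- `D ≤ n_L` at any box/width values `g`, `f` (`M_u ≤ M_L < n_L`) — the floor of the long-pair inputs «…AtQPx».`inputsLAt_of_atQPx` / «…LinksPx». [folklore] -/
theorem D_le_nL_of_atQ3VPx {κ : Consts} {V : Type} [DecidableEq V] [Countable V] {G : SimpleGraph V} [G.LocallyFinite] {Φ : PlanarSkeletonFrmQuasi G} {t : V} {p : unitInterval} {hC : Φ.CylSubcritical p} {D : ℕ} {gv : Neg.FSlot} {fv : Neg.FSlot} {Pv : PSlot} {Sv : SSlot} {cv : CSlot} {hv : CSlot} {bv : BSlot} {O : OutNS V} {q : unitInterval} (hAt : (choiceAtQ3VPx κ Φ t p D Pv gv fv Sv cv hv bv hC).AtQNQ O q) (g f : ℕ) : D ≤ nL κ Φ t p O.merged g f :=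
  (D_le_Mu_of_atQ3VPx hAt).trans ((Mu_le_ML κ Φ t p O.merged g).trans (ML_lt_nL κ Φ t p O.merged g f).1.le)

/-- `D ≤ n_Kit` at any kit index `mk` (`M_u + 3 ≤ n_Kit`) — the floor of the kit inputs «…KitPx» / «…ZoneKPx». [folklore] -/
theorem D_le_nKit_of_atQ3VPx {κ : Consts} {V : Type} [DecidableEq V] [Countable V] {G : SimpleGraph V} [G.LocallyFinite] {Φ : PlanarSkeletonFrmQuasi G} {t : V} {p : unitInterval} {hC : Φ.CylSubcritical p} {D : ℕ} {gv : Neg.FSlot} {fv : Neg.FSlot} {Pv : PSlot} {Sv : SSlot} {cv : CSlot} {hv : CSlot} {bv : BSlot} {O : OutNS V} {q : unitInterval} (hAt : (choiceAtQ3VPx κ Φ t p D Pv gv fv Sv cv hv bv hC).AtQNQ O q) (mk : ℕ) : D ≤ KS.nKit O.merged mk :=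
  (D_le_Mu_of_atQ3VPx hAt).trans (by have := (KS.nKit_facts O.merged mk).2.2.2; omega)

end AtQ

end NegB

/-! ## §3 The choice function of record under proxies at radius `D` -/

/-- **THE GEN CHOICE FUNCTION OF RECORD AT PROXY RADIUS `D`**, seven slots (box `gv`, width `fv`, extra pairs `Pv`, fibre block `Sv`, creep `cv`, forward room `hv`, arrival
box `bv`): the `ChoiceFnNQPxAt D` the four GEN column tops and the U_s node file meet (closure `drop_of_choiceFnNQLTKPx_at`) — at every skeleton with proxies it returns
`NegB.choiceAtQ3VPx … D …`; `frmChoiceAllQ3V` is the instance `D = 0` on one-type skeletons. [cite: KozmaNitzan2024, §4 Theorem 6 (pp. 25–31)] -/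
def frmChoiceAllQ3VPx (D : ℕ) (gv fv : Neg.FSlot) (Pv : NegB.PSlot) (Sv : NegB.SSlot) (cv hv : NegB.CSlot) (bv : NegB.BSlot) : ChoiceFnNQPxAt D :=
  fun κ _ _ _ _ _ Φ _ t _ _ p _ _ hC => NegB.choiceAtQ3VPx κ Φ t p D Pv gv fv Sv cv hv bv hC

/-- `frmChoiceAllQ3VPx` unfolds to `NegB.choiceAtQ3VPx` (by `rfl`). [folklore] -/
theorem frmChoiceAllQ3VPx_eq (D : ℕ) (gv fv : Neg.FSlot) (Pv : NegB.PSlot) (Sv : NegB.SSlot) (cv hv : NegB.CSlot) (bv : NegB.BSlot) (κ : Consts) {V : Type}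
    [DecidableEq V] [Countable V] (G : SimpleGraph V) [G.LocallyFinite] (Φ : PlanarSkeletonFrmQuasi G) (hg : ¬ HasExponentialGrowth G) (t : V) (ht : t ∈ Φ.types)
    (hP : Φ.HasProxies t D) (p : unitInterval) (hp0 : 0 < (p : ℝ)) (hp1 : (p : ℝ) < 1) (hC : Φ.CylSubcritical p) :
    frmChoiceAllQ3VPx D gv fv Pv Sv cv hv bv κ G Φ hg t ht hP p hp0 hp1 hC = NegB.choiceAtQ3VPx κ Φ t p D Pv gv fv Sv cv hv bv hC := rfl

/-- The scheme of the GEN choice function of record at `(O, q)` is `⟨ΓQV, q, κ.δ⟩` (by `rfl`) — the form the (R)/(F)/(C) GEN wrappers read. [folklore] -/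
theorem frmChoiceAllQ3VPx_scheme (D : ℕ) (gv fv : Neg.FSlot) (Pv : NegB.PSlot) (Sv : NegB.SSlot) (cv hv : NegB.CSlot) (bv : NegB.BSlot) (κ : Consts) {V : Type}
    [DecidableEq V] [Countable V] (G : SimpleGraph V) [G.LocallyFinite] (Φ : PlanarSkeletonFrmQuasi G) (hg : ¬ HasExponentialGrowth G) (t : V) (ht : t ∈ Φ.types)
    (hP : Φ.HasProxies t D) (p : unitInterval) (hp0 : 0 < (p : ℝ)) (hp1 : (p : ℝ) < 1) (hC : Φ.CylSubcritical p) (O : Skelφ.StepI.OutNS V) (q : unitInterval) :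
    (frmChoiceAllQ3VPx D gv fv Pv Sv cv hv bv κ G Φ hg t ht hP p hp0 hp1 hC).scheme O q = ⟨NegB.ΓQV κ Φ t p O gv fv Sv cv hv bv q, q, κ.δ⟩ := rfl

/-! ## §4 (appended) The root-bridge width floor -/

namespace NegB

open Neg

/-- `D ≤ n_B0` at any kit index `mk` (`M_u ≤ M_B0 < n_B0`, «SkelFrmFromBParamsBridge0») — the floor of the root-bridge inputs «…Bridge0Px». [folklore] -/
theorem D_le_nB0_of_atQ3VPx {κ : Consts} {V : Type} [DecidableEq V] [Countable V] {G : SimpleGraph V} [G.LocallyFinite] {Φ : PlanarSkeletonFrmQuasi G} {t : V}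
    {p : unitInterval} {hC : Φ.CylSubcritical p} {D : ℕ} {gv fv : Neg.FSlot} {Pv : PSlot} {Sv : SSlot} {cv hv : CSlot} {bv : BSlot} {O : OutNS V} {q : unitInterval}
    (hAt : (choiceAtQ3VPx κ Φ t p D Pv gv fv Sv cv hv bv hC).AtQNQ O q) (mk : ℕ) : D ≤ KS.nB0 κ Φ t p O.merged mk :=
  (D_le_Mu_of_atQ3VPx hAt).trans ((KS.MB0_floors κ Φ t p O.merged mk).2.2.trans (KS.RF2_0 κ Φ t p O.merged mk).2.1.le)

end NegB

/-! ## §5 (appended) The face-bridge width floor ((F) column, p3 g27 #5680 / lead Us-R8 'on ask') -/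

namespace NegB

open Neg

/-- `D ≤ n_BF` at any face-bridge multiplier `c` and kit index `mk` (`M_u ≤ M_BF < n_BF`, «SkelFrmFromBParamsBridgeF») — the floor of the face-bridge inputs of the (F)
column under proxies. [folklore] -/
theorem D_le_nBF_of_atQ3VPx {κ : Consts} {V : Type} [DecidableEq V] [Countable V] {G : SimpleGraph V} [G.LocallyFinite] {Φ : PlanarSkeletonFrmQuasi G} {t : V}
    {p : unitInterval} {hC : Φ.CylSubcritical p} {D : ℕ} {gv fv : Neg.FSlot} {Pv : PSlot} {Sv : SSlot} {cv hv : CSlot} {bv : BSlot} {O : OutNS V} {q : unitInterval}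
    (hAt : (choiceAtQ3VPx κ Φ t p D Pv gv fv Sv cv hv bv hC).AtQNQ O q) (c mk : ℕ) : D ≤ KS.nBF κ Φ t p O.merged c mk :=
  (D_le_Mu_of_atQ3VPx hAt).trans ((KS.MBF_floors κ Φ t p O.merged c mk).2.2.trans (KS.RF2F κ Φ t p O.merged c mk).2.1.le)

end NegB

end PlanarSkeletonFrmQuasi

end Summit.CriticalPhenomena.PercolationContinuityZ3.Theorems.Transplant

end
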